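import Literature.MathematicalPhysics.KineticTheory.TaggedBoltzmannPruning
import Literature.MathematicalPhysics.KineticTheory.HierarchyTimeSeparationBlocks
import HarnessLib

/-!
# The truncated, time-separated main term of the tagged Boltzmann hierarchy
(Bodineau–Gallagher–Saint-Raymond, Invent. Math. 203 (2016) = arXiv:1305.3397v2, §4.4 Prop. 4.3,
§5.3.1 Prop. 5.4, §5.3.2 Prop. 5.5, for the Boltzmann hierarchy `g_α`; trunk T-KINETIC, topic
MathematicalPhysics/KineticTheory; glue layer of the bottom-up proof plan of the named fact
`bgsr_theorem22` / fact (c) `bodineau_gallagher_saintRaymond_linear` recorded in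
`TaggedSphereLinearBoltzmann`.)

BGSR reduce the Boltzmann side of Theorem 2.2 to the main term of the pruned expansion with large
energies cut off and collision times separated,
`g_α = g̃^{(1,K)}_{α,E,δ} + (R^{0,K}_α) + (g^{(1,K)}_α - g^{(1,K)}_{α,E}) + (g^{(1,K)}_{α,E} - g^{(1,K)}_{α,E,δ}) + …`
(Props. 4.3, 5.4, 5.5; the further reduction to non-pathological velocities, Prop. 5.6, and the
comparison with the BBGKY side, Props. 5.7–5.8, are not here). This file assembles the three
abstract estimates already proved — `TaggedBoltzmannPruning` (Prop. 4.3 for `R^{0,K}_α`),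
`HierarchyEnergyTruncation` (Prop. 5.4) and `HierarchyTimeSeparationBlocks` (Prop. 5.5) — on
BGSR's Boltzmann family `g_α^{(s)} = φ_α ⊗ M_β^{⊗s}` (`bgsrHierarchyFamily`):

* `LinearBoltzmannData.isNice_bgsrHierarchyFamily_zero`, `…isLevelBdd_bgsrHierarchyFamily_zero`
  — the initial family `g_α(0) = ρ⁰ ⊗ M_β^{⊗s}` is in the Lanford class with the level bound
  `max(R,1) (max(1,(β/2π)^{d/2}))^k e^{-β H_k}` at every level;
* `LinearBoltzmannData.abs_bgsrHierarchyFamily_sub_truncSepMain_le` — for thresholds `n_k = A^k`,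
  `K` blocks of step `h`, energy cut-off `E` and separation `δ`:
  `|g_α^{(1)}(Kh)(Z) - (sepBlockComp δ K [1_{H ≤ E²/2} g_α(0)])^{(1)}(Z)| ≤
   2 γ^A R' C' + R' e^{-βE²/4} C' exp(6 C' c'_R h A^K) + 12 R' C' (C' c_R δ) A^{2K} exp(12 C' c_R h A^K)`
  (`R' = max(R,1)`, `C' = max(1,(β/2π)^{d/2})`, `c_R = pruneConst M β`, `c'_R = pruneConst M (β/2)`,
  `M = boltzmannModel G hG α`), under the step condition `C' c_R h ≤ γ/e²` of Prop. 4.3;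
  `…_torus` in BGSR's setting.

## References

* T. Bodineau, I. Gallagher, L. Saint-Raymond, *The Brownian motion as the limit of a
  deterministic system of hard-spheres*, Invent. Math. 203 (2016) 493–553 = arXiv:1305.3397v2,
  §4.4 Prop. 4.3 (p. 13), §5.3.1–5.3.2 Props. 5.4–5.5 (pp. 19–20 of the held text).
-/

open MeasureTheory Metric Real Set Filter Function
open scoped Nat
open Literature.Analysis.FluidPDE (Config configEnergy GCState Geometry)

namespace Literature.MathematicalPhysics.KineticTheory

noncomputable section

section Kinetic

variable {d : Type*} [Fintype d] {X : Type*}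

/-- A level bound passes to the energy cut-off of the family (`|1_{H ≤ E²/2} G| ≤ |G|`). [folklore] -/
theorem IsLevelBdd.energyTruncate {G : GCState d X} {L : ℕ} {R C₀ w : ℝ} (hG : IsLevelBdd G L R C₀ w)
    (E : ℝ) : IsLevelBdd (energyTruncate E G) L R C₀ w :=
  fun a ha Z => (abs_energyTruncate_le E G a Z).trans (hG a ha Z)

variable [TopologicalSpace X] [MeasurableSpace X] [BorelSpace X] [SecondCountableTopology X]
  [LocallyCompactSpace X] {G : Geometry d X} {β α : ℝ} {f₀ : X → EuclideanSpace ℝ d → ℝ} {R : ℝ}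

namespace LinearBoltzmannData

variable (h : LinearBoltzmannData G β α f₀ R)
include h

/-- The initial Boltzmann family `g_α(0) = f₀ ⊗ M_β^{⊗s}` is in the Lanford class at every level. [folklore] -/
theorem isNice_bgsrHierarchyFamily_zero (k : ℕ) :
    IsNice (fun Z : Config k d X => bgsrHierarchyFamily β (linearBoltzmannSeries G β α f₀) k 0 Z) :=
  (h.isNiceT_bgsrHierarchyFamily 0 k).isNice ⟨le_rfl, le_rfl⟩

omit [MeasurableSpace X] [BorelSpace X] in
/-- The initial Boltzmann family obeys the level bound `max(R,1) (max(1,(β/2π)^{d/2}))^k e^{-β H_k}`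
at all levels (a priori bound (4.7) at `t = 0`). [cite: BodineauGallagherSaintRaymondInvent2016, §4.3 (4.7), p. 12] -/
theorem isLevelBdd_bgsrHierarchyFamily_zero (L : ℕ) :
    IsLevelBdd (fun k Z => bgsrHierarchyFamily β (linearBoltzmannSeries G β α f₀) k 0 Z) L
      (max R 1) (max 1 (maxwellianConst d β)) β := by
  intro a _ Z
  have hmc : 0 < maxwellianConst d β := maxwellianConst_pos h.beta_pos
  refine (h.abs_bgsrHierarchyFamily_le a 0 Z).trans ?_
  have h0 : 0 ≤ max R 1 := le_max_of_le_right zero_le_one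
  gcongr
  exact le_max_right _ _

/-- **Props. 4.3, 5.4 and 5.5 for the Boltzmann hierarchy, assembled.** With
`M = boltzmannModel G hG α`, `R' = max(R,1)`, `C' = max(1,(β/2π)^{d/2})`, thresholds `n_k = A^k`
(`A ≥ 2`), `0 ≤ γ ≤ 1/2`, a step `h ≥ 0` with `C' c_R h ≤ γ/e²`, an energy cut-off `E` and a
separation `δ ≥ 0`, the first level of the Boltzmann family at time `Kh` differs from the
truncated, separated main term `(sepBlockComp δ K [1_{H ≤ E²/2} g_α(0)])^{(1)}` by at most the
sum of the pruning remainder (`abs_bgsrHierarchyFamily_sub_blockComp_le`), the energy-truncation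
error (`abs_blockComp_sub_energyTruncate_le`) and the time-separation error
(`abs_blockComp_sub_sepBlockComp_le_of_budget`).
[cite: BodineauGallagherSaintRaymondInvent2016, §4.4 Prop. 4.3 and §5.3 Props. 5.4–5.5, pp. 13, 19–20] -/
theorem abs_bgsrHierarchyFamily_sub_truncSepMain_le
    (hG : Measurable fun p : X × EuclideanSpace ℝ d => G.translate p.1 p.2) {A : ℕ} (hA : 2 ≤ A)
    {γ : ℝ} (hγ0 : 0 ≤ γ) (hγ : γ ≤ 1 / 2) {h' : ℝ} (hh0 : 0 ≤ h')
    (hsmall : max 1 (maxwellianConst d β) * (boltzmannModel G hG α).pruneConst β * h' ≤ γ / exp 2)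
    (E : ℝ) {δ : ℝ} (hδ : 0 ≤ δ) (K : ℕ) (Z : Config 1 d X) :
    |bgsrHierarchyFamily β (linearBoltzmannSeries G β α f₀) 1 (K * h') Z -
        (boltzmannModel G hG α).sepBlockComp δ (pruneSeq A) h' K
          (energyTruncate E fun a Z => bgsrHierarchyFamily β (linearBoltzmannSeries G β α f₀) a 0 Z) 1 Z| ≤
      2 * γ ^ A * max R 1 * max 1 (maxwellianConst d β) +
        max R 1 * exp (-(β * E ^ 2 / 4)) * max 1 (maxwellianConst d β) *
          exp (6 * (max 1 (maxwellianConst d β) * (boltzmannModel G hG α).pruneConst (β / 2) * h') *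
            (A : ℝ) ^ K) +
        12 * max R 1 * max 1 (maxwellianConst d β) *
          (max 1 (maxwellianConst d β) * (boltzmannModel G hG α).pruneConst β * δ) * (A : ℝ) ^ (2 * K) *
          exp (12 * (max 1 (maxwellianConst d β) * (boltzmannModel G hG α).pruneConst β * h') * (A : ℝ) ^ K) := by
  have hβ := h.beta_pos
  set M := boltzmannModel G hG α with hM
  set G0 : GCState d X := fun a Z => bgsrHierarchyFamily β (linearBoltzmannSeries G β α f₀) a 0 Z with hG0
  have hR' : 0 ≤ max R 1 := le_max_of_le_right zero_le_one
  have hC' : 1 ≤ max 1 (maxwellianConst d β) := le_max_left _ _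
  have hnice : ∀ k, IsNice (G0 k) := fun k => h.isNice_bgsrHierarchyFamily_zero k
  have hlev : IsLevelBdd G0 (pruneLevel A K) (max R 1) (max 1 (maxwellianConst d β)) β :=
    h.isLevelBdd_bgsrHierarchyFamily_zero _
  have h1 := h.abs_bgsrHierarchyFamily_sub_blockComp_le hG hA hγ0 hγ hh0 hsmall K Z
  have h2 := M.abs_blockComp_sub_energyTruncate_le hA hR' hC' hβ hnice K hlev hh0 E Z
  have h3 := M.abs_blockComp_sub_sepBlockComp_le_of_budget hδ hA hR' hC' hβ
    (fun k => (hnice k).energyTruncate E) K (hlev.energyTruncate E) hh0 Z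
  calc _ = |(bgsrHierarchyFamily β (linearBoltzmannSeries G β α f₀) 1 (K * h') Z -
              M.blockComp (pruneSeq A) h' K G0 1 Z) +
            (M.blockComp (pruneSeq A) h' K G0 1 Z - M.blockComp (pruneSeq A) h' K (energyTruncate E G0) 1 Z) +
            (M.blockComp (pruneSeq A) h' K (energyTruncate E G0) 1 Z -
              M.sepBlockComp δ (pruneSeq A) h' K (energyTruncate E G0) 1 Z)| := by
          congr 1; ring
    _ ≤ _ := (abs_add_three _ _ _)
    _ ≤ _ := add_le_add (add_le_add h1 h2) h3

end LinearBoltzmannData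

/-! ### On the torus -/

section Torus

local notation "𝕋" => UnitAddTorus d

/-- **Props. 4.3, 5.4, 5.5 for the Boltzmann hierarchy in BGSR's setting** (`T^d`, datum
`ρ⁰(x)`, `β > 0`, `α ≥ 0`, continuous `0 ≤ ρ⁰ ≤ R`).
[cite: BodineauGallagherSaintRaymondInvent2016, §4.4 Prop. 4.3 and §5.3 Props. 5.4–5.5, pp. 13, 19–20] -/
theorem abs_bgsrHierarchyFamily_sub_truncSepMain_le_torus {β α : ℝ} (hβ : 0 < β) (hα : 0 ≤ α)
    {ρ₀ : 𝕋 → ℝ} (hρ₀ : Continuous ρ₀) (hρ₀0 : ∀ x, 0 ≤ ρ₀ x) {R : ℝ} (hR : ∀ x, ρ₀ x ≤ R)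
    {A : ℕ} (hA : 2 ≤ A) {γ : ℝ} (hγ0 : 0 ≤ γ) (hγ : γ ≤ 1 / 2) {h : ℝ} (hh0 : 0 ≤ h)
    (hsmall : max 1 (maxwellianConst d β) *
      (boltzmannModel (Literature.Analysis.FluidPDE.Torus.geometry d) measurable_translate_torus α).pruneConst β *
        h ≤ γ / exp 2)
    (E : ℝ) {δ : ℝ} (hδ : 0 ≤ δ) (K : ℕ) (Z : Config 1 d 𝕋) :
    |bgsrHierarchyFamily β
          (linearBoltzmannSeries (Literature.Analysis.FluidPDE.Torus.geometry d) β α fun x _ => ρ₀ x) 1 (K * h) Z -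
        (boltzmannModel (Literature.Analysis.FluidPDE.Torus.geometry d) measurable_translate_torus α).sepBlockComp
          δ (pruneSeq A) h K
          (energyTruncate E fun a Z => bgsrHierarchyFamily β
            (linearBoltzmannSeries (Literature.Analysis.FluidPDE.Torus.geometry d) β α fun x _ => ρ₀ x) a 0 Z)
          1 Z| ≤
      2 * γ ^ A * max R 1 * max 1 (maxwellianConst d β) +
        max R 1 * exp (-(β * E ^ 2 / 4)) * max 1 (maxwellianConst d β) *
          exp (6 * (max 1 (maxwellianConst d β) *
            (boltzmannModel (Literature.Analysis.FluidPDE.Torus.geometry d) measurable_translate_torus α).pruneConst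
              (β / 2) * h) * (A : ℝ) ^ K) +
        12 * max R 1 * max 1 (maxwellianConst d β) *
          (max 1 (maxwellianConst d β) *
            (boltzmannModel (Literature.Analysis.FluidPDE.Torus.geometry d) measurable_translate_torus α).pruneConst
              β * δ) * (A : ℝ) ^ (2 * K) *
          exp (12 * (max 1 (maxwellianConst d β) *
            (boltzmannModel (Literature.Analysis.FluidPDE.Torus.geometry d) measurable_translate_torus α).pruneConst
              β * h) * (A : ℝ) ^ K) :=
  (linearBoltzmannData_torus hβ hα hρ₀ hρ₀0 hR).abs_bgsrHierarchyFamily_sub_truncSepMain_le _ hA hγ0 hγ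
    hh0 hsmall E hδ K Z

end Torus

end Kinetic

end

end Literature.MathematicalPhysics.KineticTheory
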